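import Summits.PneNP.PneNP.Theorems.SymmetryBudgetNoHiddenOrderValueAndDefs
import Summits.PneNP.PneNP.Theorems.SymmetryBudgetNoHiddenOrderValueGadgets
import Summits.PneNP.PneNP.Theorems.SymmetryBudgetNoHiddenOrderBitValuationCover

/-!
# `NoHiddenOrder` (stmt-PneNP-14781), (R2c) value layer V: semantics of the value module at a section node — parts and counts

Route `PneNP/SymmetryBudget`; definitions in `SymmetryBudgetNoHiddenOrderValueAndDefs.lean`.  For a label decoded to a SECTION node `I = (U, col)`
(`VAnd.Hyp`: the inputs read it; `VAnd.Ext`: the external part wires read an abstract value map `pv` on blocks): `isPart U'` reads "`U'` is the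
block of a part of `I`" (`sem_isPart_iff`), `andOk` reads "every part is valued" (`sem_andOk_iff`), and — when every part is valued, with `f` the
part values — the comparison gadget compares `f` (`sem_lessP_iff`, `sem_eqallP_iff`), `cntIs U' t` reads `ltCnt G n I f J = t` and `multGe U' q`
reads `q ≤ mult G n I f J` for the part `J` with block `U'` (`sem_cntIs_iff`, `sem_multGe_iff`).  The pasted bits are in `…ValueAndPaste.lean`.
Sorry-free; supports stmt-PneNP-14781.
-/

set_option linter.dupNamespace false -- `Summit.PneNP.PneNP.…` (D-0017 single-conjunct layout)

namespace Summit.PneNP.PneNP.Theorems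

open Finset Literature.Computability.Complexity Literature.Computability.Complexity.SymProg CGBits BranchSum

namespace VAnd

variable {ι Λ : Type*} [DecidableEq ι] [DecidableEq Λ] {P : SymProg ι Λ}
variable {V : Type*} [Fintype V] [DecidableEq V] {n : ℕ} {U : Finset V}
variable {A : VAnd P V n U} {x : ι → Bool}
variable {G : SimpleGraph V} [DecidableRel G.Adj] {I : CGInst V}

variable (G) in
/-- **The inputs read the decoded section node `I`** (block `U`, colours `< n`, components, switching tests). -/
structure Hyp (A : VAnd P V n U) (x : ι → Bool) (I : CGInst V) : Prop where
  /-- the block is `U` -/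
  blk : I.1.1 = U
  /-- the node is a section node -/
  step : cgStep G I = .andNode (cgParts G I)
  /-- membership -/
  mem_iff : ∀ u, wval x (P.sem x) (A.mem u) = true ↔ u ∈ I.1.1
  /-- values -/
  val_iff : ∀ u (c : Fin n), wval x (P.sem x) (A.val u c) = true ↔ I.1.2 u = c
  /-- components -/
  reach_iff : ∀ u w, wval x (P.sem x) (A.reach u w) = true ↔ u ∈ I.1.1 ∧ w ∈ swReach G I.1.1 I.1.2 u
  /-- switching tests, on the block -/
  tw_iff : ∀ u ∈ I.1.1, ∀ w ∈ I.1.1, wval x (P.sem x) (A.tw u w) = true ↔ SwComp G I.1.1 I.1.2 u w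
  /-- colours are `< n` on the block -/
  wf : Wf n I
  /-- the width bounds the number of vertices -/
  hn : Fintype.card V ≤ n

/-- **The external part wires read the values `pv` of the part labels** (indexed by blocks). -/
structure Ext (A : VAnd P V n U) (x : ι → Bool) (pv : Finset V → Option (BVal n)) : Prop where
  /-- `ptOk U'` -/
  ok_iff : ∀ U' ∈ partSets U, wval x (P.sem x) (A.ptOk U') = true ↔ pv U' ≠ none
  /-- `ptBit U' b` -/
  bit_iff : ∀ U' ∈ partSets U, ∀ E, pv U' = some E → ∀ b, wval x (P.sem x) (A.ptBit U' b) = true ↔ E b = true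

variable {pv : Finset V → Option (BVal n)} (h : A.Hyp G x I) (he : A.Ext x pv)
include h

/-! ### Parts -/

omit [Fintype V] [DecidableRel G.Adj] h in
/-- Membership in `partSets`. [folklore] -/
theorem mem_partSets_iff {U' : Finset V} : U' ∈ partSets U ↔ U' ⊆ U ∧ U'.Nonempty ∧ U' ≠ U := by
  unfold partSets; rw [mem_filter, mem_powerset]

/-- The section condition of the node. [folklore] -/
theorem hdisc : ∃ u ∈ I.1.1, swReach G I.1.1 I.1.2 u ≠ I.1.1 := (cgStep_eq_andNode_iff.1 h.step).1

/-- Blocks of parts are proper non-empty subsets of `U`. [folklore] -/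
theorem block_mem_partSets {J : CGInst V} (hJ : J ∈ cgParts G I) : J.1.1 ∈ partSets U := by
  rw [mem_partSets_iff, ← h.blk]
  have hss := cgParts_ssubset (hdisc h) hJ
  exact ⟨hss.1, J.2, hss.ne⟩

omit [Fintype V] h in
/-- Parts are determined by their blocks. [folklore] -/
theorem part_eq_of_block_eq {J J' : CGInst V} (hJ : J ∈ cgParts G I) (hJ' : J' ∈ cgParts G I) (hb : J.1.1 = J'.1.1) : J = J' :=
  Subtype.ext (Prod.ext hb ((mem_cgParts_iff.1 hJ).1.trans (mem_cgParts_iff.1 hJ').1.symm))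

/-- `partAt u U'` for `u ∈ U'`: the component of `u` is `U'`. [folklore] -/
theorem sem_partAt_iff {u : V} {U' : Finset V} (hu : u ∈ U') :
    P.sem x (A.partAt u U') = true ↔ u ∈ I.1.1 ∧ swReach G I.1.1 I.1.2 u = U' := by
  rw [P.sem_and (A.kind_partAt u U'), A.srcs_partAt]
  simp only [mem_union, mem_image, mem_sdiff, mem_univ, true_and]
  have hnr : ∀ w, P.sem x (A.nreach u w) = true ↔ ¬ (u ∈ I.1.1 ∧ w ∈ swReach G I.1.1 I.1.2 u) := fun w => by
    rw [P.sem_nor_singleton (A.kind_nreach u w) (A.srcs_nreach u w), Bool.not_eq_true', ← Bool.not_eq_true, h.reach_iff]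
  constructor
  · intro H
    have hin : ∀ w ∈ U', u ∈ I.1.1 ∧ w ∈ swReach G I.1.1 I.1.2 u := fun w hw => (h.reach_iff u w).1 (H _ (Or.inl ⟨w, hw, rfl⟩))
    have hout : ∀ w ∉ U', ¬ (u ∈ I.1.1 ∧ w ∈ swReach G I.1.1 I.1.2 u) := fun w hw => by
      have := H _ (Or.inr ⟨w, hw, rfl⟩); rwa [wval_inr, hnr] at this
    have huA : u ∈ I.1.1 := (hin u hu).1
    refine ⟨huA, ?_⟩
    ext w
    exact ⟨fun hw => by_contra fun hwU => hout w hwU ⟨huA, hw⟩, fun hw => (hin w hw).2⟩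
  · rintro ⟨huA, hU⟩ w (⟨w', hw', rfl⟩ | ⟨w', hw', rfl⟩)
    · rw [h.reach_iff, hU]; exact ⟨huA, hw'⟩
    · rw [wval_inr, hnr, hU]; exact fun h' => hw' h'.2

/-- **`isPart U'`** reads "`U'` is the block of a part". [folklore] -/
theorem sem_isPart_iff (U' : Finset V) : P.sem x (A.isPart U') = true ↔ ∃ J ∈ cgParts G I, J.1.1 = U' := by
  rw [P.sem_or (A.kind_isPart U'), A.srcs_isPart]
  split_ifs with hU'
  · simp only [mem_image, exists_exists_and_eq_and, wval_inr]
    constructor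
    · rintro ⟨u, hu, hp⟩
      obtain ⟨huA, hU⟩ := (sem_partAt_iff h hu).1 hp
      exact ⟨⟨(swReach G I.1.1 I.1.2 u, I.1.2), ⟨u, self_mem_swReach _ huA⟩⟩,
        mem_cgParts_iff.2 ⟨rfl, mem_image_of_mem (fun u => swReach G I.1.1 I.1.2 u) huA⟩, hU⟩
    · rintro ⟨J, hJ, rfl⟩
      obtain ⟨-, hK⟩ := mem_cgParts_iff.1 hJ
      obtain ⟨a, ha, hKa⟩ := mem_image.1 hK
      obtain ⟨u, hu⟩ := J.2
      have huK : u ∈ swReach G I.1.1 I.1.2 a := hKa ▸ hu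
      refine ⟨u, hu, (sem_partAt_iff h hu).2 ⟨swReach_subset _ _ _ huK, ?_⟩⟩
      rw [swReach_eq_of_mem _ ha huK, hKa]
  · simp only [notMem_empty, false_and, exists_false, false_iff, not_exists, not_and]
    rintro J hJ rfl
    exact hU' (block_mem_partSets h hJ)

/-- `nisPart`. [folklore] -/
theorem sem_nisPart_iff (U' : Finset V) : P.sem x (A.nisPart U') = true ↔ ¬ ∃ J ∈ cgParts G I, J.1.1 = U' := by
  rw [P.sem_nor_singleton (A.kind_nisPart U') (A.srcs_nisPart U'), wval_inr, Bool.not_eq_true', ← Bool.not_eq_true, sem_isPart_iff h]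

include he

/-- **`andOk`** reads "every part label is valued". [folklore] -/
theorem sem_andOk_iff : P.sem x A.andOk = true ↔ ∀ J ∈ cgParts G I, pv J.1.1 ≠ none := by
  rw [P.sem_and A.kind_andOk, A.srcs_andOk]
  simp only [mem_image, forall_exists_index, and_imp, forall_apply_eq_imp_iff₂, wval_inr]
  have himp : ∀ U' ∈ partSets U, (P.sem x (A.imp U') = true ↔ ((∃ J ∈ cgParts G I, J.1.1 = U') → pv U' ≠ none)) := by
    intro U' hU'
    rw [P.sem_or (A.kind_imp U'), A.srcs_imp]
    simp only [mem_insert, mem_singleton, exists_eq_or_imp, exists_eq_left, wval_inr, sem_nisPart_iff h, he.ok_iff U' hU']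
    constructor
    · intro h' hJ
      exact h'.resolve_left (not_not.2 hJ)
    · intro h'
      by_cases hJ : ∃ J ∈ cgParts G I, J.1.1 = U'
      · exact Or.inr (h' hJ)
      · exact Or.inl hJ
  constructor
  · intro H J hJ
    exact (himp _ (block_mem_partSets h hJ)).1 (H _ (block_mem_partSets h hJ)) ⟨J, hJ, rfl⟩
  · intro H U' hU'
    rw [himp U' hU']
    rintro ⟨J, hJ, rfl⟩
    exact H J hJ

/-! ### Part values and their comparison -/

variable {f : CGInst V → BVal n} (hf : ∀ J ∈ cgParts G I, pv J.1.1 = some (f J))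
include hf

/-- The comparison vector of the block of a part is the part's value. [folklore] -/
theorem VP_B_eq {J : CGInst V} (hJ : J ∈ cgParts G I) : A.VP.B x J.1.1 = f J := by
  funext b
  unfold VecCmp.B
  rw [A.VP_b, Bool.eq_iff_iff, he.bit_iff _ (block_mem_partSets h hJ) _ (hf J hJ)]

/-- `less` between part blocks compares the part values. [folklore] -/
theorem sem_lessP_iff {J J' : CGInst V} (hJ : J ∈ cgParts G I) (hJ' : J' ∈ cgParts G I) :
    P.sem x (A.VP.less J.1.1 J'.1.1) = true ↔ toLex (f J) < toLex (f J') := by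
  rw [A.VP.sem_less, VP_B_eq h he hf hJ, VP_B_eq h he hf hJ']

/-- `eqall` between part blocks. [folklore] -/
theorem sem_eqallP_iff {J J' : CGInst V} (hJ : J ∈ cgParts G I) (hJ' : J' ∈ cgParts G I) :
    P.sem x (A.VP.eqall J.1.1 J'.1.1) = true ↔ f J = f J' := by
  rw [A.VP.sem_eqall, VP_B_eq h he hf hJ, VP_B_eq h he hf hJ']

/-! ### The counts -/

/-- `pg U' U'' u`: `u` is a vertex of a part `U''` of smaller value. [folklore] -/
theorem sem_pg_iff {J : CGInst V} (hJ : J ∈ cgParts G I) (U'' : Finset V) (u : V) :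
    P.sem x (A.pg J.1.1 U'' u) = true ↔ u ∈ U'' ∧ ∃ J'' ∈ cgParts G I, J''.1.1 = U'' ∧ toLex (f J'') < toLex (f J) := by
  by_cases hu : u ∈ U''
  · have hk : P.kind (A.pg J.1.1 U'' u) = Kind.and := by rw [A.kind_pg, if_pos hu]
    rw [P.sem_and hk, A.srcs_pg, if_pos hu]
    simp only [mem_insert, mem_singleton, forall_eq_or_imp, forall_eq, wval_inr, sem_isPart_iff h, hu, true_and]
    constructor
    · rintro ⟨⟨J'', hJ'', rfl⟩, hl⟩
      exact ⟨J'', hJ'', rfl, (sem_lessP_iff h he hf hJ'' hJ).1 hl⟩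
    · rintro ⟨J'', hJ'', rfl, hl⟩
      exact ⟨⟨J'', hJ'', rfl⟩, (sem_lessP_iff h he hf hJ'' hJ).2 hl⟩
  · have hk : P.kind (A.pg J.1.1 U'' u) = Kind.or := by rw [A.kind_pg, if_neg hu]
    rw [P.sem_or hk, A.srcs_pg, if_neg hu]
    simp [hu]

/-- **The pair count is `ltCnt`.** [folklore] -/
theorem trueCount_pg {J : CGInst V} (hJ : J ∈ cgParts G I) :
    P.trueCount x ((partSets U ×ˢ (univ : Finset V)).image fun Uu => Sum.inr (A.pg J.1.1 Uu.1 Uu.2)) = ltCnt G n I f J := by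
  classical
  unfold SymProg.trueCount
  rw [filter_image, card_image_of_injective _ (fun a b hab => A.pg_injective J.1.1 (Sum.inr_injective hab))]
  -- the true pairs are the pairs (block of a smaller part, vertex of it)
  have hset : ((partSets U ×ˢ (univ : Finset V)).filter fun Uu => wval x (P.sem x) (Sum.inr (A.pg J.1.1 Uu.1 Uu.2)) = true) =
      ((cgParts G I).filter fun J'' => toLex (f J'') < toLex (f J)).biUnion fun J'' => J''.1.1.map ⟨fun u => (J''.1.1, u), fun a b hab => by
        simpa using hab⟩ := by
    ext ⟨U'', u⟩
    simp only [mem_filter, mem_product, mem_univ, and_true, wval_inr, sem_pg_iff h he hf hJ, mem_biUnion, mem_map,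
      Function.Embedding.coeFn_mk, Prod.mk.injEq]
    constructor
    · rintro ⟨-, hu, J'', hJ'', rfl, hl⟩
      exact ⟨J'', ⟨hJ'', hl⟩, u, hu, rfl, rfl⟩
    · rintro ⟨J'', ⟨hJ'', hl⟩, u', hu', rfl, rfl⟩
      exact ⟨block_mem_partSets h hJ'', hu', J'', hJ'', rfl, hl⟩
  rw [hset, card_biUnion]
  · unfold ltCnt
    exact sum_congr rfl fun J'' _ => card_map _
  · intro J₁ h₁ J₂ h₂ hne
    rw [Function.onFun, disjoint_left]
    rintro ⟨U'', u⟩ hm₁ hm₂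
    simp only [mem_map, Function.Embedding.coeFn_mk, Prod.mk.injEq] at hm₁ hm₂
    obtain ⟨-, -, rfl, -⟩ := hm₁
    obtain ⟨-, -, hb, -⟩ := hm₂
    exact hne (part_eq_of_block_eq (mem_filter.1 h₁).1 (mem_filter.1 h₂).1 hb.symm)

/-- `cntGe U' t` reads `t ≤ ltCnt`. [folklore] -/
theorem sem_cntGe_iff {J : CGInst V} (hJ : J ∈ cgParts G I) (t : Fin (n + 2)) :
    P.sem x (A.cntGe J.1.1 t) = true ↔ (t : ℕ) ≤ ltCnt G n I f J := by
  rw [P.sem_atLeast_trueCount (A.kind_cntGe _ t) (A.srcs_cntGe _ t), trueCount_pg h he hf hJ]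

/-- **`cntIs U' t`** reads `ltCnt = t`. [folklore] -/
theorem sem_cntIs_iff {J : CGInst V} (hJ : J ∈ cgParts G I) (t : Fin (n + 1)) :
    P.sem x (A.cntIs J.1.1 t) = true ↔ ltCnt G n I f J = t := by
  rw [P.sem_and (A.kind_cntIs _ t), A.srcs_cntIs]
  simp only [mem_insert, mem_singleton, forall_eq_or_imp, forall_eq, wval_inr, sem_cntGe_iff h he hf hJ,
    P.sem_nor_singleton (A.kind_ncntGe _ _) (A.srcs_ncntGe _ _), Bool.not_eq_true']
  rw [← Bool.not_eq_true, sem_cntGe_iff h he hf hJ]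
  simp only [Fin.val_castSucc, Fin.val_succ, not_le]
  omega

/-- `eqp U' U''`: `U''` is the block of a part with the value of `U'`. [folklore] -/
theorem sem_eqp_iff {J : CGInst V} (hJ : J ∈ cgParts G I) (U'' : Finset V) :
    P.sem x (A.eqp J.1.1 U'') = true ↔ ∃ J'' ∈ cgParts G I, J''.1.1 = U'' ∧ f J'' = f J := by
  rw [P.sem_and (A.kind_eqp _ U''), A.srcs_eqp]
  simp only [mem_insert, mem_singleton, forall_eq_or_imp, forall_eq, wval_inr, sem_isPart_iff h]
  constructor
  · rintro ⟨⟨J'', hJ'', rfl⟩, heq⟩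
    exact ⟨J'', hJ'', rfl, (sem_eqallP_iff h he hf hJ'' hJ).1 heq⟩
  · rintro ⟨J'', hJ'', rfl, heq⟩
    exact ⟨⟨J'', hJ'', rfl⟩, (sem_eqallP_iff h he hf hJ'' hJ).2 heq⟩

/-- **The class count is `mult`.** [folklore] -/
theorem trueCount_eqp {J : CGInst V} (hJ : J ∈ cgParts G I) :
    P.trueCount x ((partSets U).image fun U'' => Sum.inr (A.eqp J.1.1 U'')) = mult G n I f J := by
  classical
  unfold SymProg.trueCount
  rw [filter_image, card_image_of_injective _ (fun a b hab => A.eqp_injective J.1.1 (Sum.inr_injective hab))]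
  have hset : ((partSets U).filter fun U'' => wval x (P.sem x) (Sum.inr (A.eqp J.1.1 U'')) = true) =
      ((cgParts G I).filter fun J'' => f J'' = f J).image fun J'' => J''.1.1 := by
    ext U''
    simp only [mem_filter, wval_inr, sem_eqp_iff h he hf hJ, mem_image]
    constructor
    · rintro ⟨-, J'', hJ'', rfl, heq⟩; exact ⟨J'', ⟨hJ'', heq⟩, rfl⟩
    · rintro ⟨J'', ⟨hJ'', heq⟩, rfl⟩; exact ⟨block_mem_partSets h hJ'', J'', hJ'', rfl, heq⟩
  rw [hset, card_image_of_injOn]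
  · rfl
  · intro J₁ h₁ J₂ h₂ hb
    exact part_eq_of_block_eq (mem_filter.1 h₁).1 (mem_filter.1 h₂).1 hb

/-- **`multGe U' q`** reads `q ≤ mult`. [folklore] -/
theorem sem_multGe_iff {J : CGInst V} (hJ : J ∈ cgParts G I) (q : Fin (n + 2)) :
    P.sem x (A.multGe J.1.1 q) = true ↔ (q : ℕ) ≤ mult G n I f J := by
  rw [P.sem_atLeast_trueCount (A.kind_multGe _ q) (A.srcs_multGe _ q), trueCount_eqp h he hf hJ]

end VAnd

end Summit.PneNP.PneNP.Theorems
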